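import Summits.QuantumFields.YangMills.Theorems.BalabanUVNodesN15VectorPieceV1Gauge
import HarnessLib

/-!
# Route «BalabanUVNodes» (K4 «SpineRates»), node N15 = NE2 — THE STAIRCASE CONTOUR SUMS `Σ_{b ∈ Γ_{y,x}} A(b)` OF A BOND FUNCTION FROM THE BLOCK CORNER, AND
# THEIR TWO-SPACING FIT THROUGH KING's PAIRING: the fine contour to `x′` projects onto the coarse contour to `pr x′` (`L^m` fine bonds over each coarse bond)
# up to a remainder of `< L^m` bonds per direction, so `‖η′·Σ_{Γ′} A′ − η·Σ_{Γ} Ā‖ ≤ (d+1)·(L^kL^mη′·Ω + L^mη′·r)` from the pointwise fit `‖A′(b′) − Ā(pr b′)‖ ≤ Ω`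

Cell `pub-ymgap`, seat `pub-ymgap-dag-n15-c` (generation g4; R134 ACCELERATION SEAT, strategy s1 «first missing estimate»; HUMAN RULING D-0062; chair R424 venue;
`bears_on: R4∕N15`).  Filed `--supports stmt-QuantumFields-19908 --as helper` (K3′; helper).  THEOREMS + 5 plumbing defs; imports BY NAME, nothing in the tree
modified: this seat's (V4) `…N15VectorPieceV1Gauge` (through it n15-a's `kingPr`∕`kingPrV`∕`kingPr_val`, part 8 `pr_bpt`, b05 `B5Block118.bpt`∕`B5Blocks16.bpt_bijective`).

WHY.  The (V5) chain (`…N15BackgroundAveragingWords` → `…N15VectorPieceVWords`) reads `NE2PlusOperator` out by name with the averaging words of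
[Balaban1985BackgroundPropagators] (3.60) live for ANY averaging-perturbation species `F₂(A′)` carrying two letters.  The print's `F′₂ⱼ(A; y, x)` ((3.55)–(3.58)
pp. 401–402) is built from parallel transports `U′U(Γ^{(j)}_{y,x})` along the STAIRCASE CONTOURS `Γ_{y,x}` from the block's base point to `x`; to FIRST ORDER in
`A′` its kernel is `i·ad(η Σ_{b ∈ Γ_{y,x}} A′(b))`.  THIS FILE types the contour sums on b05's torus blocks and proves the one estimate their two-spacing fit needs:
under King's pairing `pr = ⌊·∕L^m⌋` the fine staircase to `x′ = L^mL^k·y + a′` projects, bond by bond, onto the coarse staircase to `pr x′ = L^k·y + ⌊a′∕L^m⌋`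
(`L^m` fine bonds over each coarse bond), except for `a′_μ mod L^m < L^m` trailing fine bonds per direction; hence with `η = L^m·η′` the scaled sums differ by at
most `(d+1)·(L^k·L^m·η′·Ω + L^m·η′·r)` whenever `‖A′‖ ≤ r` and `‖A′(b′) − Ā(pr b′)‖ ≤ Ω` pointwise (for Bałaban's `A′` and its fibrewise mean: `Ω` = the fibre
oscillation, (V4)'s `fibre_conn_kingPrV`).  The sequel turns this into the linearised `F₂` species and its letters.

CONTENTS.  §1 `stair` (the staircase offset; `stair_of_lt`∕`stair_self`∕`stair_of_gt`), `stairSum` (the contour sum in block coordinates), `norm_stairSum_le`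
(`≤ (d+1)·n·r`), `blockCoords` (`blockCoords_bpt`, `bpt_blockCoords`), `lineSum` (`lineSum_bpt`, `norm_lineSum_le`).  §2 two spacings `n = L^k`, `n′ = L^mL^k`: `hdig`
(King's digits `⌊a′∕L^m⌋`; `kingPr_bpt_hdig`), `tidx s j = L^m·s + j` (`tidx_val`, `tidx_div`, `tidx_lt_of_lt`, `not_tidx_lt_of_gt`, `tidx_bijective`, `sum_tidx`),
`hdig_stair_tidx`, `kingPrV_bpt_stair_tidx` (THE PROJECTION OF THE FINE CONTOUR), `smul_eq_sum_smul`; ★ **`norm_stairSum_two_spacing_le`**, **`norm_lineSum_two_spacing_le`**.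

HONEST FRAMING ∕ LIMITS.  Elementary lattice combinatorics on the b05 tori (every `L ≥ 1`, `k`, `m`, `M`); the contour is the coordinate-ordered staircase from
the block's BASE POINT (b05's `bpt y 0`), our reading of [5]'s `Γ^{(j)}_{y,x}` at one level — NOT the multi-level contour of (3.55), NOT the parallel transport
itself (the sequel uses the FIRST-ORDER kernel only); no estimate of Bałaban's is involved.  RELATED, NOT DUPLICATED: the Literature's `LatticeFieldCalculus.stairSum`
(`T4` site families), `B4Prop31Holonomy.stairSum` (`ℤ^{d+1}`), `B5Block118.lineSum` (the straight lines of (1.18)) live on other carriers and are not consumable on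
b05's block coordinates with King's pairing.  Count-neutral (typed 28∕28 · discharged unchanged); NOT a discharge of
N15; one finite T⁴ at fixed ε — NOT infinite volume, NOT OS on ℝ⁴, NOT a mass gap, NOT Clay.
-/

noncomputable section

open scoped BigOperators
open Finset

namespace Summit.QuantumFields.YangMills.BalabanUVNodes.N15.VectorPiece

open Literature.MathematicalPhysics.QuantumFieldTheory.Balaban1983to89
open Literature.MathematicalPhysics.QuantumFieldTheory.Balaban1983to89.B5Prop11Plancherel (Tor fine)
open Literature.MathematicalPhysics.QuantumFieldTheory.Balaban1983to89.B5Block118 (bpt)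
open Literature.MathematicalPhysics.QuantumFieldTheory.Balaban1983to89.B5Blocks16 (bpt_bijective)
open Summit.QuantumFields.YangMills.BalabanUVNodes.N15.DefectKernel (pr_bpt)

variable {d : ℕ}

/-! ## §1 The staircase contour sum from the block corner -/

section Stair

variable {n : ℕ} [NeZero n]

/-- THE STAIRCASE OFFSET: on leg `μ` at height `t`, the coordinates `< μ` are already at their target `a`, coordinate `μ` is at `t`, the later ones still at `0`.
[cite: Balaban1985BackgroundPropagators, (3.55) p.401 (the contours `Γ_{y,x}`: shape)] -/
def stair (a : Fin (d + 1) → Fin n) (μ : Fin (d + 1)) (t : Fin n) : Fin (d + 1) → Fin n :=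
  fun ν => if ν < μ then a ν else if ν = μ then t else ⟨0, Nat.pos_of_ne_zero (NeZero.ne n)⟩

/-- Earlier coordinates are frozen at the target. [folklore] -/
theorem stair_of_lt (a : Fin (d + 1) → Fin n) {μ ν : Fin (d + 1)} (t : Fin n) (h : ν < μ) : stair a μ t ν = a ν := by simp [stair, h]

/-- The running coordinate. [folklore] -/
@[simp] theorem stair_self (a : Fin (d + 1) → Fin n) (μ : Fin (d + 1)) (t : Fin n) : stair a μ t μ = t := by simp [stair]

/-- Later coordinates are still at the corner. [folklore] -/
theorem stair_of_gt (a : Fin (d + 1) → Fin n) {μ ν : Fin (d + 1)} (t : Fin n) (h : μ < ν) : (stair a μ t ν : ℕ) = 0 := by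
  simp [stair, not_lt.2 h.le, ne_of_gt h]

end Stair

section Sum

variable (n : ℕ) [NeZero n] (M : Fin (d + 1) → ℕ) [∀ μ, NeZero (M μ)] {E : Type} [SeminormedAddCommGroup E] [NormedSpace ℝ E]

/-- THE STAIRCASE CONTOUR SUM in block coordinates: for the fine point `x = n·y + a` of the block of `y` and a component `ν`, the sum of the bond function `f_μ`
over the bonds `(n·y + stair a μ t, μ)`, `t < a_μ`, `μ = 0, …, d` — the staircase from the block corner `n·y` to `x`, read on the `ν`-slice of the carrier.
[cite: Balaban1985BackgroundPropagators, (3.55)–(3.57) p.401 («U(Γ_{y,x})»: the contour, shape; here its first-order sum)] -/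
def stairSum (f : Fin (d + 1) → Tor (fine n M) × Fin (d + 1) → E) (y : Tor M) (a : Fin (d + 1) → Fin n) (ν : Fin (d + 1)) : E :=
  ∑ μ, ∑ t : Fin n, if (t : ℕ) < a μ then f μ (bpt n M y (stair a μ t), ν) else 0

omit [∀ μ, NeZero (M μ)] [NormedSpace ℝ E] in
/-- A contour has at most `(d+1)·n` bonds: `‖stairSum‖ ≤ (d+1)·n·r` when `‖f‖ ≤ r` (`r ≥ 0`). [folklore] -/
theorem norm_stairSum_le {f : Fin (d + 1) → Tor (fine n M) × Fin (d + 1) → E} {r : ℝ} (hr : 0 ≤ r) (hf : ∀ μ b, ‖f μ b‖ ≤ r)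
    (y : Tor M) (a : Fin (d + 1) → Fin n) (ν : Fin (d + 1)) : ‖stairSum n M f y a ν‖ ≤ (d + 1) * n * r := by
  unfold stairSum
  calc ‖∑ μ, ∑ t : Fin n, if (t : ℕ) < a μ then f μ (bpt n M y (stair a μ t), ν) else 0‖
      ≤ ∑ μ, ‖∑ t : Fin n, if (t : ℕ) < a μ then f μ (bpt n M y (stair a μ t), ν) else 0‖ := norm_sum_le _ _
    _ ≤ ∑ _μ : Fin (d + 1), (n : ℝ) * r := Finset.sum_le_sum fun μ _ => by
        calc ‖∑ t : Fin n, if (t : ℕ) < a μ then f μ (bpt n M y (stair a μ t), ν) else 0‖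
            ≤ ∑ t : Fin n, ‖if (t : ℕ) < a μ then f μ (bpt n M y (stair a μ t), ν) else 0‖ := norm_sum_le _ _
          _ ≤ ∑ _t : Fin n, r := Finset.sum_le_sum fun t _ => by
              split_ifs
              · exact hf μ _
              · rw [norm_zero]; exact hr
          _ = n * r := by rw [Finset.sum_const, Finset.card_univ, Fintype.card_fin, nsmul_eq_mul]
    _ = (d + 1) * n * r := by rw [Finset.sum_const, Finset.card_univ, Fintype.card_fin, nsmul_eq_mul]; push_cast; ring

/-- THE BLOCK COORDINATES `(y, a)` of a fine point `x = n·y + a` (inverse of b05's block parametrisation). [cite: Balaban1984PropagatorsI, (1.6) p.18] -/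
def blockCoords (x : Tor (fine n M)) : Tor M × (Fin (d + 1) → Fin n) := (Equiv.ofBijective _ (bpt_bijective n M)).symm x

/-- `blockCoords (n·y + a) = (y, a)`. [folklore] -/
@[simp] theorem blockCoords_bpt (y : Tor M) (a : Fin (d + 1) → Fin n) : blockCoords n M (bpt n M y a) = (y, a) :=
  (Equiv.ofBijective _ (bpt_bijective n M)).symm_apply_apply (y, a)

/-- `n·y + a = x` for `(y, a) = blockCoords x`. [folklore] -/
theorem bpt_blockCoords (x : Tor (fine n M)) : bpt n M (blockCoords n M x).1 (blockCoords n M x).2 = x :=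
  (Equiv.ofBijective _ (bpt_bijective n M)).apply_symm_apply x

/-- THE CONTOUR SUM at a carrier point `(x, ν)`: the staircase sum from the corner of `x`'s block to `x`. [cite: Balaban1985BackgroundPropagators, (3.55)–(3.57) p.401 (shape)] -/
def lineSum (f : Fin (d + 1) → Tor (fine n M) × Fin (d + 1) → E) (p : Tor (fine n M) × Fin (d + 1)) : E :=
  stairSum n M f (blockCoords n M p.1).1 (blockCoords n M p.1).2 p.2

omit [NormedSpace ℝ E] in
/-- In block coordinates. [folklore] -/
theorem lineSum_bpt (f : Fin (d + 1) → Tor (fine n M) × Fin (d + 1) → E) (y : Tor M) (a : Fin (d + 1) → Fin n) (ν : Fin (d + 1)) :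
    lineSum n M f (bpt n M y a, ν) = stairSum n M f y a ν := by
  simp [lineSum]

omit [NormedSpace ℝ E] in
/-- `‖lineSum‖ ≤ (d+1)·n·r`. [folklore] -/
theorem norm_lineSum_le {f : Fin (d + 1) → Tor (fine n M) × Fin (d + 1) → E} {r : ℝ} (hr : 0 ≤ r) (hf : ∀ μ b, ‖f μ b‖ ≤ r) (p : Tor (fine n M) × Fin (d + 1)) :
    ‖lineSum n M f p‖ ≤ (d + 1) * n * r :=
  norm_stairSum_le n M hr hf _ _ _

end Sum

/-! ## §2 Two spacings: the fine contour projects onto the coarse contour -/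

section TwoSpacings

variable (L k m : ℕ) [NeZero L] (M : Fin (d + 1) → ℕ) [∀ μ, NeZero (M μ)]

/-- KING's DIGITS of a fine offset: `⌊a′_ν ∕ L^m⌋` — the offset of `pr x′` in the same unit block (`pr_bpt`). [cite: King1986, p.664 («x′ ∈ B^n(x)»)] -/
def hdig (a' : Fin (d + 1) → Fin (L ^ m * L ^ k)) : Fin (d + 1) → Fin (L ^ k) := fun ν => ⟨(a' ν : ℕ) / L ^ m, Nat.div_lt_of_lt_mul (a' ν).isLt⟩

/-- `pr (L^mL^k·y + a′) = L^k·y + hdig a′`. [cite: King1986, p.664 («x′ ∈ B^n(x)»)] -/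
theorem kingPr_bpt_hdig (y : Tor M) (a' : Fin (d + 1) → Fin (L ^ m * L ^ k)) :
    kingPr L k m M (bpt (L ^ m * L ^ k) M y a') = bpt (L ^ k) M y (hdig L k m a') :=
  pr_bpt (L ^ m) (L ^ k) M (kingPr L k m M) (kingPr_val L k m M) y a' (hdig L k m a') fun _ => rfl

/-- THE FINE HEIGHT `L^m·s + j` over the coarse height `s`, digit `j`. [folklore] -/
def tidx (s : Fin (L ^ k)) (j : Fin (L ^ m)) : Fin (L ^ m * L ^ k) :=
  ⟨L ^ m * s + j, by
    calc L ^ m * (s : ℕ) + j < L ^ m * s + L ^ m := Nat.add_lt_add_left j.isLt _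
      _ = L ^ m * (s + 1) := by ring
      _ ≤ L ^ m * L ^ k := Nat.mul_le_mul_left _ (Nat.succ_le_of_lt s.isLt)⟩

omit [NeZero L] in
/-- Value. [folklore] -/
@[simp] theorem tidx_val (s : Fin (L ^ k)) (j : Fin (L ^ m)) : (tidx L k m s j : ℕ) = L ^ m * s + j := rfl

/-- `⌊(L^m·s + j) ∕ L^m⌋ = s`. [folklore] -/
theorem tidx_div (s : Fin (L ^ k)) (j : Fin (L ^ m)) : (tidx L k m s j : ℕ) / L ^ m = s := by
  have hLm : 0 < L ^ m := pos_of_ne_zero (NeZero.ne (L ^ m))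
  rw [tidx_val, show L ^ m * (s : ℕ) + j = (j : ℕ) + L ^ m * s by ring, Nat.add_mul_div_left _ _ hLm, Nat.div_eq_of_lt j.isLt, zero_add]

omit [NeZero L] in
/-- Below the digit: every fine height over `s < ⌊a′∕L^m⌋` lies below `a′`. [folklore] -/
theorem tidx_lt_of_lt {a' : ℕ} {s : Fin (L ^ k)} (h : (s : ℕ) < a' / L ^ m) (j : Fin (L ^ m)) : (tidx L k m s j : ℕ) < a' := by
  rw [tidx_val]
  calc L ^ m * (s : ℕ) + j < L ^ m * s + L ^ m := Nat.add_lt_add_left j.isLt _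
    _ = L ^ m * (s + 1) := by ring
    _ ≤ L ^ m * (a' / L ^ m) := Nat.mul_le_mul_left _ (Nat.succ_le_of_lt h)
    _ ≤ a' := Nat.mul_div_le a' (L ^ m)

/-- Above the digit: no fine height over `s > ⌊a′∕L^m⌋` lies below `a′`. [folklore] -/
theorem not_tidx_lt_of_gt {a' : ℕ} {s : Fin (L ^ k)} (h : a' / L ^ m < (s : ℕ)) (j : Fin (L ^ m)) : ¬ (tidx L k m s j : ℕ) < a' := by
  have hLm : 0 < L ^ m := pos_of_ne_zero (NeZero.ne (L ^ m))
  rw [tidx_val, not_lt]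
  calc a' ≤ L ^ m * (a' / L ^ m + 1) := (Nat.lt_mul_div_succ a' hLm).le
    _ ≤ L ^ m * s := Nat.mul_le_mul_left _ (Nat.succ_le_of_lt h)
    _ ≤ L ^ m * s + j := Nat.le_add_right _ _

/-- `(s, j) ↦ L^m·s + j` is a bijection `[0, L^k) × [0, L^m) → [0, L^mL^k)`. [folklore] -/
theorem tidx_bijective : Function.Bijective (fun p : Fin (L ^ k) × Fin (L ^ m) => tidx L k m p.1 p.2) := by
  have hLm : 0 < L ^ m := pos_of_ne_zero (NeZero.ne (L ^ m))
  refine (Fintype.bijective_iff_injective_and_card _).2 ⟨fun p q hpq => ?_, by simp [mul_comm]⟩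
  have hv : (tidx L k m p.1 p.2 : ℕ) = (tidx L k m q.1 q.2 : ℕ) := congrArg Fin.val hpq
  have hs : (p.1 : ℕ) = q.1 := by rw [← tidx_div L k m p.1 p.2, ← tidx_div L k m q.1 q.2, hv]
  have hj : (p.2 : ℕ) = q.2 := by rw [tidx_val, tidx_val, hs] at hv; omega
  exact Prod.ext (Fin.ext hs) (Fin.ext hj)

/-- Reindexing a sum over the fine heights by (coarse height, digit). [folklore] -/
theorem sum_tidx {E : Type} [AddCommMonoid E] (G : Fin (L ^ m * L ^ k) → E) : ∑ t', G t' = ∑ s : Fin (L ^ k), ∑ j : Fin (L ^ m), G (tidx L k m s j) := by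
  rw [← Fintype.sum_prod_type']
  exact (Fintype.sum_bijective _ (tidx_bijective L k m) (fun p => G (tidx L k m p.1 p.2)) G fun _ => rfl).symm

/-- King's digits of a fine staircase offset at height `L^m·s + j` ARE the coarse staircase offset at height `s`. [folklore] -/
theorem hdig_stair_tidx (a' : Fin (d + 1) → Fin (L ^ m * L ^ k)) (μ : Fin (d + 1)) (s : Fin (L ^ k)) (j : Fin (L ^ m)) :
    hdig L k m (stair a' μ (tidx L k m s j)) = stair (hdig L k m a') μ s := by
  have hLm : 0 < L ^ m := pos_of_ne_zero (NeZero.ne (L ^ m))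
  funext ν
  apply Fin.ext
  show (stair a' μ (tidx L k m s j) ν : ℕ) / L ^ m = (stair (hdig L k m a') μ s ν : ℕ)
  rcases lt_trichotomy ν μ with h | h | h
  · rw [stair_of_lt _ _ h, stair_of_lt _ _ h]; rfl
  · subst h; rw [stair_self, stair_self, tidx_div]
  · rw [stair_of_gt _ _ h, stair_of_gt _ _ h, Nat.zero_div]

/-- **THE FINE CONTOUR PROJECTS ONTO THE COARSE CONTOUR**: King's bond pairing sends the fine staircase bond at height `L^m·s + j` of leg `μ` (component `ν`) to
the coarse staircase bond at height `s` of leg `μ`. [cite: King1986, p.664 («x′ ∈ B^n(x)»)] -/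
theorem kingPrV_bpt_stair_tidx (y : Tor M) (a' : Fin (d + 1) → Fin (L ^ m * L ^ k)) (μ ν : Fin (d + 1)) (s : Fin (L ^ k)) (j : Fin (L ^ m)) :
    kingPrV L k m M (bpt (L ^ m * L ^ k) M y (stair a' μ (tidx L k m s j)), ν) = (bpt (L ^ k) M y (stair (hdig L k m a') μ s), ν) := by
  rw [kingPrV_eq, kingPr_bpt_hdig, hdig_stair_tidx]

omit [NeZero L] [∀ μ, NeZero (M μ)] in
/-- `η•X = Σ_{j < L^m} η′•X` when `η = L^m·η′`. [folklore] -/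
theorem smul_eq_sum_smul {E : Type} [AddCommGroup E] [Module ℝ E] (X : E) {η η' : ℝ} (hη : η = (L ^ m : ℕ) * η') :
    η • X = ∑ _j : Fin (L ^ m), η' • X := by
  rw [Finset.sum_const, Finset.card_univ, Fintype.card_fin, ← Nat.cast_smul_eq_nsmul ℝ, smul_smul, hη]

variable {E : Type} [SeminormedAddCommGroup E] [NormedSpace ℝ E]

/-- **THE TWO-SPACING FIT OF THE CONTOUR SUMS.**  Fine level `n′ = L^mL^k`, coarse level `n = L^k`, `η = L^m·η′`, `η′ ≥ 0`; a fine bond function `f′` with `‖f′‖ ≤ r` and a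
coarse one `f` with the POINTWISE fit `‖f′_μ(b′) − f_μ(pr b′)‖ ≤ Ω` through King's bond pairing (`r, Ω ≥ 0`).  Then, in one unit block `y`, for the fine offset `a′` and
its digits `hdig a′` (the offset of `pr x′`): `‖η′•stairSum′ f′ y a′ ν − η•stairSum f y (hdig a′) ν‖ ≤ (d+1)·(L^k·L^m·η′·Ω + L^m·η′·r)` — leg by leg, the `L^m` fine
bonds over each coarse bond below the digit cost `η′Ω` each, the `< L^m` trailing fine bonds at the digit cost `η′r` each, nothing lies above.
[cite: Balaban1985BackgroundPropagators, (3.57)–(3.58) pp.401–402 (the contour products whose first-order kernel this sum is: shape); King1986, p.664 (the pairing)] -/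
theorem norm_stairSum_two_spacing_le {f' : Fin (d + 1) → Tor (fine (L ^ m * L ^ k) M) × Fin (d + 1) → E}
    {f : Fin (d + 1) → Tor (fine (L ^ k) M) × Fin (d + 1) → E} {r Ω η η' : ℝ} (hr : 0 ≤ r) (hΩ : 0 ≤ Ω) (hη' : 0 ≤ η')
    (hη : η = (L ^ m : ℕ) * η') (hf' : ∀ μ b, ‖f' μ b‖ ≤ r) (hfit : ∀ μ b', ‖f' μ b' - f μ (kingPrV L k m M b')‖ ≤ Ω)
    (y : Tor M) (a' : Fin (d + 1) → Fin (L ^ m * L ^ k)) (ν : Fin (d + 1)) :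
    ‖η' • stairSum (L ^ m * L ^ k) M f' y a' ν - η • stairSum (L ^ k) M f y (hdig L k m a') ν‖ ≤
      (d + 1) * ((L ^ k : ℕ) * (L ^ m : ℕ) * η' * Ω + (L ^ m : ℕ) * η' * r) := by
  -- both sums over (leg, coarse height, digit)
  set T' : Fin (d + 1) → Fin (L ^ k) → Fin (L ^ m) → E := fun μ s j =>
    η' • (if (tidx L k m s j : ℕ) < a' μ then f' μ (bpt (L ^ m * L ^ k) M y (stair a' μ (tidx L k m s j)), ν) else 0) with hT'
  set T : Fin (d + 1) → Fin (L ^ k) → Fin (L ^ m) → E := fun μ s _ =>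
    η' • (if (s : ℕ) < hdig L k m a' μ then f μ (bpt (L ^ k) M y (stair (hdig L k m a') μ s), ν) else 0) with hT
  have hfine : η' • stairSum (L ^ m * L ^ k) M f' y a' ν = ∑ μ, ∑ s : Fin (L ^ k), ∑ j : Fin (L ^ m), T' μ s j := by
    unfold stairSum
    rw [Finset.smul_sum]
    refine Finset.sum_congr rfl fun μ _ => ?_
    rw [sum_tidx L k m, Finset.smul_sum]
    refine Finset.sum_congr rfl fun s _ => ?_
    rw [Finset.smul_sum]
  have hcoarse : η • stairSum (L ^ k) M f y (hdig L k m a') ν = ∑ μ, ∑ s : Fin (L ^ k), ∑ j : Fin (L ^ m), T μ s j := by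
    unfold stairSum
    rw [Finset.smul_sum]
    refine Finset.sum_congr rfl fun μ _ => ?_
    rw [Finset.smul_sum]
    refine Finset.sum_congr rfl fun s _ => ?_
    exact smul_eq_sum_smul L m _ hη
  -- the per-bond bound
  have hterm : ∀ μ s j, ‖T' μ s j - T μ s j‖ ≤ η' * Ω + (if s = hdig L k m a' μ then η' * r else 0) := by
    intro μ s j
    simp only [hT', hT]
    have hdμ : (hdig L k m a' μ : ℕ) = (a' μ : ℕ) / L ^ m := rfl
    rcases lt_trichotomy (s : ℕ) (hdig L k m a' μ) with hs | hs | hs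
    · -- below the digit: a projected fine bond
      have hlt : (tidx L k m s j : ℕ) < a' μ := tidx_lt_of_lt L k m (by rw [← hdμ]; exact hs) j
      have hne : s ≠ hdig L k m a' μ := fun h => (ne_of_lt hs) (congrArg Fin.val h)
      rw [if_pos hlt, if_pos hs, if_neg hne, add_zero, ← smul_sub, norm_smul, Real.norm_eq_abs, abs_of_nonneg hη',
        ← kingPrV_bpt_stair_tidx L k m M y a' μ ν s j]
      exact mul_le_mul_of_nonneg_left (hfit μ _) hη'
    · -- at the digit: a trailing fine bond (or nothing)
      have heq : s = hdig L k m a' μ := Fin.ext hs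
      have hns : ¬ ((s : ℕ) < (hdig L k m a' μ : ℕ)) := by rw [hs]; exact lt_irrefl _
      rw [if_neg hns, if_pos heq, smul_zero, sub_zero]
      refine le_trans ?_ (le_add_of_nonneg_left (mul_nonneg hη' hΩ))
      rw [norm_smul, Real.norm_eq_abs, abs_of_nonneg hη']
      refine mul_le_mul_of_nonneg_left ?_ hη'
      split_ifs
      · exact hf' μ _
      · rw [norm_zero]; exact hr
    · -- above the digit: nothing on either side
      have hnlt : ¬ (tidx L k m s j : ℕ) < a' μ := not_tidx_lt_of_gt L k m (by rw [← hdμ]; exact hs) j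
      have hne : s ≠ hdig L k m a' μ := fun h => (ne_of_gt hs) (congrArg Fin.val h)
      have hns : ¬ ((s : ℕ) < (hdig L k m a' μ : ℕ)) := not_lt.2 hs.le
      rw [if_neg hnlt, if_neg hns, if_neg hne, smul_zero, sub_zero, norm_zero, add_zero]
      exact mul_nonneg hη' hΩ
  -- summation
  rw [hfine, hcoarse, ← Finset.sum_sub_distrib]
  calc ‖∑ μ, (∑ s : Fin (L ^ k), ∑ j : Fin (L ^ m), T' μ s j - ∑ s : Fin (L ^ k), ∑ j : Fin (L ^ m), T μ s j)‖
      ≤ ∑ μ, ‖∑ s : Fin (L ^ k), ∑ j : Fin (L ^ m), T' μ s j - ∑ s : Fin (L ^ k), ∑ j : Fin (L ^ m), T μ s j‖ := norm_sum_le _ _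
    _ ≤ ∑ _μ : Fin (d + 1), ((L ^ k : ℕ) * (L ^ m : ℕ) * η' * Ω + (L ^ m : ℕ) * η' * r) := Finset.sum_le_sum fun μ _ => by
        rw [← Finset.sum_sub_distrib]
        calc ‖∑ s : Fin (L ^ k), (∑ j : Fin (L ^ m), T' μ s j - ∑ j : Fin (L ^ m), T μ s j)‖
            ≤ ∑ s : Fin (L ^ k), ‖∑ j : Fin (L ^ m), T' μ s j - ∑ j : Fin (L ^ m), T μ s j‖ := norm_sum_le _ _
          _ ≤ ∑ s : Fin (L ^ k), ∑ j : Fin (L ^ m), (η' * Ω + (if s = hdig L k m a' μ then η' * r else 0)) :=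
              Finset.sum_le_sum fun s _ => by
                rw [← Finset.sum_sub_distrib]
                exact (norm_sum_le _ _).trans (Finset.sum_le_sum fun j _ => hterm μ s j)
          _ = ∑ s : Fin (L ^ k), ((L ^ m : ℕ) * (η' * Ω) + (L ^ m : ℕ) * (if s = hdig L k m a' μ then η' * r else 0)) :=
              Finset.sum_congr rfl fun s _ => by rw [Finset.sum_const, Finset.card_univ, Fintype.card_fin, nsmul_eq_mul, mul_add]
          _ = (L ^ k : ℕ) * ((L ^ m : ℕ) * (η' * Ω)) + (L ^ m : ℕ) * (η' * r) := by
              rw [Finset.sum_add_distrib, Finset.sum_const, Finset.card_univ, Fintype.card_fin, nsmul_eq_mul, ← Finset.mul_sum,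
                Finset.sum_ite_eq' Finset.univ (hdig L k m a' μ) (fun _ => η' * r), if_pos (Finset.mem_univ _)]
          _ = (L ^ k : ℕ) * (L ^ m : ℕ) * η' * Ω + (L ^ m : ℕ) * η' * r := by ring
    _ = (d + 1) * ((L ^ k : ℕ) * (L ^ m : ℕ) * η' * Ω + (L ^ m : ℕ) * η' * r) := by
        rw [Finset.sum_const, Finset.card_univ, Fintype.card_fin, nsmul_eq_mul]; push_cast; ring

/-- **THE SAME, AT A FINE CARRIER POINT**: `‖η′•lineSum′ f′ (x′, ν) − η•lineSum f (pr x′, ν)‖ ≤ (d+1)·(L^kL^mη′·Ω + L^mη′·r)` — the fine contour sum to `x′` against the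
coarse contour sum to King's `pr x′` (same unit block, offset = the digits). [cite: Balaban1985BackgroundPropagators, (3.57)–(3.58) pp.401–402 (shape); King1986, p.664] -/
theorem norm_lineSum_two_spacing_le {f' : Fin (d + 1) → Tor (fine (L ^ m * L ^ k) M) × Fin (d + 1) → E}
    {f : Fin (d + 1) → Tor (fine (L ^ k) M) × Fin (d + 1) → E} {r Ω η η' : ℝ} (hr : 0 ≤ r) (hΩ : 0 ≤ Ω) (hη' : 0 ≤ η')
    (hη : η = (L ^ m : ℕ) * η') (hf' : ∀ μ b, ‖f' μ b‖ ≤ r) (hfit : ∀ μ b', ‖f' μ b' - f μ (kingPrV L k m M b')‖ ≤ Ω)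
    (p' : Tor (fine (L ^ m * L ^ k) M) × Fin (d + 1)) :
    ‖η' • lineSum (L ^ m * L ^ k) M f' p' - η • lineSum (L ^ k) M f (kingPrV L k m M p')‖ ≤
      (d + 1) * ((L ^ k : ℕ) * (L ^ m : ℕ) * η' * Ω + (L ^ m : ℕ) * η' * r) := by
  obtain ⟨⟨y, a'⟩, hx⟩ := (bpt_bijective (L ^ m * L ^ k) M).2 p'.1
  simp only at hx
  have hp : p' = (bpt (L ^ m * L ^ k) M y a', p'.2) := Prod.ext hx.symm rfl
  rw [hp, kingPrV_eq, kingPr_bpt_hdig, lineSum_bpt, lineSum_bpt]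
  exact norm_stairSum_two_spacing_le L k m M hr hΩ hη' hη hf' hfit y a' p'.2

end TwoSpacings

end Summit.QuantumFields.YangMills.BalabanUVNodes.N15.VectorPiece

end
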